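import Summits.BirchSwinnertonDyer.Rank1Residual.X2.NonPrimitiveQuotientCorank
import Summits.BirchSwinnertonDyer.Rank1Residual.Iwasawa.UnramifiedConditionFiniteOrbit
import Summits.BirchSwinnertonDyer.Rank1Residual.Iwasawa.InertiaCohomologyPTorsionFinite
import Literature.NumberTheory.EllipticCurves.Kobayashi2003.SignedSelmer
import Literature.NumberTheory.EllipticCurves.GreenbergVatsal2000.GreenbergSelmerGroups
import HarnessLib

/-!
# `corank_{ℤ_p}(Sel♯_{S₀}/Sel♯_∅) ≤ Σ_{v∈S₀} N_v · c_v` for the IMPRIMITIVE SIGNED Selmer groups — the injective half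
# (`Sel♯_{S₀}/Sel♯_∅ ↪ ∏_{v∈S₀} ∏_{n<N_v} H¹(I_η, E[p^∞])`, GV 2000 §2 p. 20) of the registered stub `stub_locCard2` of line `bridge` v20
# (crux `SignedTransportAtTwo`, stmt-BirchSwinnertonDyer-20333, route `ThetaPartnerAtTwo`) (lead prover bsd-wall-tp2-p1 g6; `--supports`;
# route-independent, closes nothing)

HONEST FRAMING. THEOREMS ONLY, no definition; BSD is not proved by any of this; the LOWER half (global-to-local surjectivity, GV Prop. (2.1))
and the exact per-place coranks (GV Prop. (2.4) / Matsuno 2008 Lemma 2.4) are NOT proved here. This file is the signed twin of the X2 cell's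
`NonPrimitiveQuotientCorank.zpCorank_quotient_le_sum` (Greenberg-datum Selmer groups): the condition at the places above `p` — here
Kobayashi's signed Kummer condition w.r.t. `⨆ₙ E^ε(K_n·K_v)` — is common to `Sel♯_{S₀}` and `Sel♯_∅` and plays no role; the groups are
SPELLED OUT (`unramifiedOutside κ.kerSubgroup E[p^∞] p S ⊓ ⨅_{v ∣ p, σ} conj_σ⁻¹(localKummerOverOfEmb … (⨆ₙ signedLocalPoints …))`).

* `mem_sharp_empty_iff` — `c ∈ Sel♯_∅ ↔ c ∈ Sel♯_{S₀} ∧ (∀ v ∈ S₀, v ∤ p, ∀ σ, conj_σ c unramified at v)`;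
* `zpCorank_sharp_quotient_le_sum` — for any number field `K`, prime `p`, `ℤ_p`-extension `κ` with topological generator `γ`, sign `ε`,
  finite `S₀ ∌ (v ∣ p)`, representative numbers `N_v` (`Γ_K = H·D_v·{γⁿ : n < N_v}`) and per-place corank bounds `c_v` on the subgroups of the
  image of `H¹(H, E[p^∞]) → H¹(H ∩ I_v, E[p^∞])`: `corank_{ℤ_p}(Sel♯_{S₀}/Sel♯_∅) ≤ Σ_{v∈S₀} N_v·c_v`.

References: [GreenbergVatsal2000] §2 pp. 17, 20–22 (Cor. (2.3) upper half, Prop. (2.4)); [Kobayashi2003] Def. 1.1; [GreenbergLNM1716] §1 p. 60.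
-/

set_option autoImplicit false
-- D-0017: single-problem summit, so `Summit.BirchSwinnertonDyer.BirchSwinnertonDyer.…` repeats a namespace BY DESIGN.
set_option linter.dupNamespace false

noncomputable section

open scoped Classical AddSubgroup

open NumberField IsDedekindDomain Field CategoryTheory
open Literature.NumberTheory.GaloisRepresentations Literature.NumberTheory.EllipticCurves
  Literature.NumberTheory.EllipticCurves.GreenbergSelmer
  Literature.NumberTheory.EllipticCurves.GreenbergVatsal2000
  Literature.NumberTheory.EllipticCurves.Kobayashi2003
  Summit.BirchSwinnertonDyer.Rank1Residual.Iwasawa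
  Summit.BirchSwinnertonDyer.Rank1Residual.X2.NonPrimitiveQuotientCorank

namespace Summit.BirchSwinnertonDyer.BirchSwinnertonDyer.Theorems.SignedTransportAtTwo

universe u

variable {K : Type u} [Field K] [NumberField K] (W : WeierstrassCurve K) [W.IsElliptic]
  {p : ℕ} [Fact p.Prime] (κ : ZpExtension K p) {γ : absoluteGaloisGroup K}

omit [W.IsElliptic] in
/-- **`Sel♯_∅` inside `Sel♯_{S₀}`**: a class lies in `Sel♯_∅` iff it lies in `Sel♯_{S₀}` and all its conjugates are unramified at every
`v ∈ S₀`, `v ∤ p` (the condition above `p` is common). GV p. 20 ("Obviously, `S_A(ℚ_∞) ⊆ S^{Σ₀}_A(ℚ_∞)`" and the kernel of the local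
map at `Σ₀`). [cite: GreenbergVatsal2000, §2 p. 20] -/
theorem mem_sharp_empty_iff (ε : ℤˣ) (S₀ : Set (HeightOneSpectrum (𝓞 K))) (c : W.subgroupH1 p κ.kerSubgroup) :
    c ∈ unramifiedOutside κ.kerSubgroup ↥(W.geomPrimaryTorsion p) p (∅ : Set (HeightOneSpectrum (𝓞 K))) ⊓
        ⨅ (v : HeightOneSpectrum (𝓞 K)) (_ : ((p : ℕ) : 𝓞 K) ∈ v.asIdeal) (σ : absoluteGaloisGroup K),
          (localKummerOverOfEmb W p κ.kerSubgroup (closureEmb (K := K) (v.adicCompletion K))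
              (⨆ n : ℕ, signedLocalPoints κ (v.adicCompletion K) W ε n)).comap (W.conjH1 p κ.kerSubgroup σ) ↔
      c ∈ (unramifiedOutside κ.kerSubgroup ↥(W.geomPrimaryTorsion p) p S₀ ⊓
          ⨅ (v : HeightOneSpectrum (𝓞 K)) (_ : ((p : ℕ) : 𝓞 K) ∈ v.asIdeal) (σ : absoluteGaloisGroup K),
            (localKummerOverOfEmb W p κ.kerSubgroup (closureEmb (K := K) (v.adicCompletion K))
                (⨆ n : ℕ, signedLocalPoints κ (v.adicCompletion K) W ε n)).comap (W.conjH1 p κ.kerSubgroup σ)) ∧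
        ∀ v ∈ S₀, ((p : ℕ) : 𝓞 K) ∉ v.asIdeal → ∀ σ : absoluteGaloisGroup K,
          conjH1 κ.kerSubgroup ↥(W.geomPrimaryTorsion p) σ c ∈ unramifiedKer κ.kerSubgroup ↥(W.geomPrimaryTorsion p) v := by
  rw [AddSubgroup.mem_inf, AddSubgroup.mem_inf, mem_unramifiedOutside_iff, mem_unramifiedOutside_iff]
  constructor
  · rintro ⟨hunr, hp⟩
    exact ⟨⟨fun v _ hpv σ ↦ hunr v (Set.notMem_empty v) hpv σ, hp⟩, fun v _ hpv σ ↦ hunr v (Set.notMem_empty v) hpv σ⟩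
  · rintro ⟨⟨hunr, hp⟩, hS₀⟩
    refine ⟨fun v _ hpv σ ↦ ?_, hp⟩
    by_cases hv : v ∈ S₀
    · exact hS₀ v hv hpv σ
    · exact hunr v hv hpv σ

-- adapted from `X2.NonPrimitiveQuotientCorank.zpCorank_quotient_le_sum` (Greenberg-datum Selmer groups), signed condition at `p` instead
/-- **`corank_{ℤ_p}(Sel♯_{S₀}/Sel♯_∅) ≤ Σ_{v∈S₀} N_v · c_v`** for the imprimitive SIGNED Selmer groups of `E` over `K_∞` (any number field,
any prime, any `ℤ_p`-extension with topological generator `γ`, any sign), granted at each `v ∈ S₀`: the representative property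
`Γ_K = H · D_v · {γⁿ : n < N_v}` (`hrep`) and a bound `c_v` on the corank of every subgroup of the image of
`r_v : H¹(H, E[p^∞]) → H¹(H ∩ I_v, E[p^∞])` (`hloc`). The detecting map `(r_v ∘ conj_{γⁿ})_{v∈S₀, n<N_v}` has kernel `Sel♯_∅` on `Sel♯_{S₀}`
and lands in a product of `p`-primary groups with finite `p`-torsion — the UPPER half of GV's
`corank S^{Σ₀}/S = Σ_{ℓ∈Σ₀} corank 𝓗_ℓ(ℚ_∞)` for Kobayashi's condition at `p` (the equality needs Prop. (2.1)).
[cite: GreenbergVatsal2000, §2 pp. 17, 20–22] [cite: Kobayashi2003, Def. 1.1] -/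
theorem zpCorank_sharp_quotient_le_sum (ε : ℤˣ)
    (S₀ : Finset (HeightOneSpectrum (𝓞 K))) (hS₀ : ∀ v ∈ S₀, ((p : ℕ) : 𝓞 K) ∉ v.asIdeal)
    (N c : HeightOneSpectrum (𝓞 K) → ℕ)
    (hrep : ∀ v ∈ S₀, ∀ σ : absoluteGaloisGroup K, ∃ n < N v, ∃ δ ∈ decomp (K := K) v,
      ∃ h ∈ κ.kerSubgroup, σ = h * (δ * γ ^ n))
    (hloc : ∀ v ∈ S₀, ∀ Y : AddSubgroup (discreteH1 (inertiaIn κ.kerSubgroup v) (W.geomPrimaryTorsion p)),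
      (∀ y ∈ Y, ∃ c : subgroupH1 κ.kerSubgroup (W.geomPrimaryTorsion p),
        resH1Hom (inertiaInToH κ.kerSubgroup v) (AddMonoidHom.id (W.geomPrimaryTorsion p))
          (fun _ _ ↦ rfl) c = y) →
      zpCorank Y p ≤ c v) :
    zpCorank (↥(unramifiedOutside κ.kerSubgroup ↥(W.geomPrimaryTorsion p) p (↑S₀ : Set (HeightOneSpectrum (𝓞 K))) ⊓
          ⨅ (v : HeightOneSpectrum (𝓞 K)) (_ : ((p : ℕ) : 𝓞 K) ∈ v.asIdeal) (σ : absoluteGaloisGroup K),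
            (localKummerOverOfEmb W p κ.kerSubgroup (closureEmb (K := K) (v.adicCompletion K))
                (⨆ n : ℕ, signedLocalPoints κ (v.adicCompletion K) W ε n)).comap (W.conjH1 p κ.kerSubgroup σ)) ⧸
      (unramifiedOutside κ.kerSubgroup ↥(W.geomPrimaryTorsion p) p (∅ : Set (HeightOneSpectrum (𝓞 K))) ⊓
          ⨅ (v : HeightOneSpectrum (𝓞 K)) (_ : ((p : ℕ) : 𝓞 K) ∈ v.asIdeal) (σ : absoluteGaloisGroup K),
            (localKummerOverOfEmb W p κ.kerSubgroup (closureEmb (K := K) (v.adicCompletion K))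
                (⨆ n : ℕ, signedLocalPoints κ (v.adicCompletion K) W ε n)).comap (W.conjH1 p κ.kerSubgroup σ)).addSubgroupOf
        (unramifiedOutside κ.kerSubgroup ↥(W.geomPrimaryTorsion p) p (↑S₀ : Set (HeightOneSpectrum (𝓞 K))) ⊓
          ⨅ (v : HeightOneSpectrum (𝓞 K)) (_ : ((p : ℕ) : 𝓞 K) ∈ v.asIdeal) (σ : absoluteGaloisGroup K),
            (localKummerOverOfEmb W p κ.kerSubgroup (closureEmb (K := K) (v.adicCompletion K))
                (⨆ n : ℕ, signedLocalPoints κ (v.adicCompletion K) W ε n)).comap (W.conjH1 p κ.kerSubgroup σ))) p ≤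
      ∑ v ∈ S₀, N v * c v := by
  haveI : κ.kerSubgroup.Normal := by rw [ZpExtension.kerSubgroup]; infer_instance
  set H := κ.kerSubgroup with hH
  set A := W.geomPrimaryTorsion p with hA
  set SS := (unramifiedOutside κ.kerSubgroup ↥(W.geomPrimaryTorsion p) p (↑S₀ : Set (HeightOneSpectrum (𝓞 K))) ⊓
    ⨅ (v : HeightOneSpectrum (𝓞 K)) (_ : ((p : ℕ) : 𝓞 K) ∈ v.asIdeal) (σ : absoluteGaloisGroup K),
      (localKummerOverOfEmb W p κ.kerSubgroup (closureEmb (K := K) (v.adicCompletion K))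
          (⨆ n : ℕ, signedLocalPoints κ (v.adicCompletion K) W ε n)).comap (W.conjH1 p κ.kerSubgroup σ)) with hSS
  set S := (unramifiedOutside κ.kerSubgroup ↥(W.geomPrimaryTorsion p) p (∅ : Set (HeightOneSpectrum (𝓞 K))) ⊓
    ⨅ (v : HeightOneSpectrum (𝓞 K)) (_ : ((p : ℕ) : 𝓞 K) ∈ v.asIdeal) (σ : absoluteGaloisGroup K),
      (localKummerOverOfEmb W p κ.kerSubgroup (closureEmb (K := K) (v.adicCompletion K))
          (⨆ n : ℕ, signedLocalPoints κ (v.adicCompletion K) W ε n)).comap (W.conjH1 p κ.kerSubgroup σ)) with hS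
  let ι := ↥S₀
  -- the detecting map
  let Φ : W.subgroupH1 p H →+ (Π i : ι, Fin (N i.1) → discreteH1 (inertiaIn H i.1) A) :=
    AddMonoidHom.pi fun i ↦ AddMonoidHom.pi fun n ↦
      (resH1Hom (inertiaInToH H i.1) (AddMonoidHom.id A) fun _ _ ↦ rfl).comp
        (conjH1 H A (γ ^ (n : ℕ)))
  have hΦ : ∀ (x : W.subgroupH1 p H) (i : ι) (n : Fin (N i.1)),
      Φ x i n = resH1Hom (inertiaInToH H i.1) (AddMonoidHom.id A) (fun _ _ ↦ rfl)
        (conjH1 H A (γ ^ (n : ℕ)) x) := fun _ _ _ ↦ rfl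
  let φ : SS →+ (Π i : ι, Fin (N i.1) → discreteH1 (inertiaIn H i.1) A) := Φ.comp SS.subtype
  -- (a) the kernel of `φ` is `S`
  have hker : ∀ s : SS, φ s = 0 ↔ (s : W.subgroupH1 p H) ∈ S := by
    intro s
    constructor
    · intro h0
      rw [hS, mem_sharp_empty_iff W κ ε (↑S₀ : Set _)]
      refine ⟨s.2, fun v hv hpv σ ↦ ?_⟩
      refine forall_conjH1_mem_unramifiedKer_of_forall_lt κ A
        (hrep v (Finset.mem_coe.1 hv)) (fun n hn ↦ ?_) σ
      have h := congrFun (congrFun h0 ⟨v, Finset.mem_coe.1 hv⟩) ⟨n, hn⟩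
      rw [show φ s ⟨v, Finset.mem_coe.1 hv⟩ ⟨n, hn⟩ = Φ (s : W.subgroupH1 p H) ⟨v, _⟩ ⟨n, hn⟩
        from rfl, hΦ] at h
      exact h
    · intro hs
      funext i n
      rw [show φ s i n = Φ (s : W.subgroupH1 p H) i n from rfl, hΦ]
      exact ((mem_sharp_empty_iff W κ ε (↑S₀ : Set _) _).1 hs).2 i.1
        (Finset.mem_coe.2 i.2) (hS₀ i.1 i.2) (γ ^ (n : ℕ))
  have hkerEq : φ.ker = S.addSubgroupOf SS := by
    ext s
    rw [AddMonoidHom.mem_ker, AddSubgroup.mem_addSubgroupOf]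
    exact hker s
  -- (b) `SS/S ≅ range φ`
  have hcongr : zpCorank (↥SS ⧸ S.addSubgroupOf SS) p = zpCorank φ.range p := by
    refine zpCorank_congr ?_ p
    exact (QuotientAddGroup.quotientAddEquivOfEq hkerEq).symm.trans
      (QuotientAddGroup.quotientKerEquivRange φ)
  rw [hcongr]
  -- (c) the images `Y_{v,n}` and the product `B`
  let Yv : ∀ i : ι, Fin (N i.1) → AddSubgroup (discreteH1 (inertiaIn H i.1) A) := fun i n ↦
    (((resH1Hom (inertiaInToH H i.1) (AddMonoidHom.id A) fun _ _ ↦ rfl).comp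
      (conjH1 H A (γ ^ (n : ℕ)))).comp SS.subtype).range
  have hYprim : ∀ (i : ι) (n : Fin (N i.1)) (y : Yv i n), ∃ k : ℕ, p ^ k • y = 0 := by
    rintro i n ⟨_, ⟨s, rfl⟩⟩
    obtain ⟨k, hk⟩ := W.exists_pow_smul_subgroupH1_ker_eq_zero κ (s : W.subgroupH1 p H)
    refine ⟨k, Subtype.ext ?_⟩
    change p ^ k • ((resH1Hom (inertiaInToH H i.1) (AddMonoidHom.id A) fun _ _ ↦ rfl)
      (conjH1 H A (γ ^ (n : ℕ)) (s : W.subgroupH1 p H))) = 0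
    rw [← map_nsmul, ← map_nsmul, hk, map_zero, map_zero]
  have hYfin : ∀ (i : ι) (n : Fin (N i.1)), Finite ((↥(Yv i n))[(p : ℤ)]) := by
    intro i n
    have hfin := finite_setOf_nsmul_eq_zero_discreteH1_inertiaIn W κ i.1 (hS₀ i.1 i.2)
    haveI := hfin.to_subtype
    refine Finite.of_injective (fun y : (↥(Yv i n))[(p : ℤ)] ↦
      (⟨((y : Yv i n) : discreteH1 (inertiaIn H i.1) A), ?_⟩ :
        {x : discreteH1 (inertiaIn H i.1) A | p • x = 0})) ?_
    · have h := AddSubgroup.torsionBy.nsmul_iff.1 y.2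
      change p • ((y : Yv i n) : discreteH1 (inertiaIn H i.1) A) = 0
      rw [← AddSubmonoidClass.coe_nsmul, h, ZeroMemClass.coe_zero]
    · intro y z hyz
      have h := congrArg Subtype.val hyz
      exact Subtype.ext (Subtype.ext h)
  -- inner and outer products
  have hinner : ∀ i : ι, zpCorank (∀ n : Fin (N i.1), Yv i n) p ≤ N i.1 * c i.1 := by
    intro i
    haveI : ∀ n : Fin (N i.1), Finite ((↥(Yv i n))[(p : ℤ)]) := hYfin i
    rw [zpCorank_pi (hYprim i)]
    calc ∑ n : Fin (N i.1), zpCorank (Yv i n) p ≤ ∑ _n : Fin (N i.1), c i.1 :=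
          Finset.sum_le_sum fun n _ ↦ hloc i.1 i.2 (Yv i n) (by
            rintro _ ⟨s, rfl⟩
            exact ⟨conjH1 H A (γ ^ (n : ℕ)) (s : W.subgroupH1 p H), rfl⟩)
      _ = N i.1 * c i.1 := by rw [Finset.sum_const, Finset.card_univ, Fintype.card_fin, smul_eq_mul]
  have hBprim : ∀ b : (∀ i : ι, ∀ n : Fin (N i.1), Yv i n), ∃ k : ℕ, p ^ k • b = 0 :=
    primary_pi fun i ↦ primary_pi (hYprim i)
  haveI hBfin : Finite ((∀ i : ι, ∀ n : Fin (N i.1), Yv i n)[(p : ℤ)]) := by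
    haveI : ∀ i : ι, Finite ((∀ n : Fin (N i.1), Yv i n)[(p : ℤ)]) := fun i ↦ by
      haveI : ∀ n : Fin (N i.1), Finite ((↥(Yv i n))[(p : ℤ)]) := hYfin i
      exact finite_torsionBy_pi
    exact finite_torsionBy_pi
  -- (d) `range φ ↪ B`
  let j : φ.range →+ (∀ i : ι, ∀ n : Fin (N i.1), Yv i n) :=
    { toFun := fun y ↦ fun i n ↦ ⟨(y : ∀ i : ι, Fin (N i.1) → discreteH1 (inertiaIn H i.1) A) i n, by
        obtain ⟨s, hs⟩ := y.2
        exact ⟨s, congrFun (congrFun hs i) n⟩⟩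
      map_zero' := by funext i n; rfl
      map_add' := fun y z ↦ by funext i n; rfl }
  have hj : Function.Injective j := by
    intro y z hyz
    apply Subtype.ext
    funext i n
    have h := congrArg (fun f : (∀ i : ι, ∀ n : Fin (N i.1), Yv i n) ↦
      ((f i n : Yv i n) : discreteH1 (inertiaIn H i.1) A)) hyz
    exact h
  calc zpCorank φ.range p ≤ zpCorank (∀ i : ι, ∀ n : Fin (N i.1), Yv i n) p :=
        zpCorank_le_of_injective j hj hBprim
    _ = ∑ i : ι, zpCorank (∀ n : Fin (N i.1), Yv i n) p := by
        haveI : ∀ i : ι, Finite ((∀ n : Fin (N i.1), Yv i n)[(p : ℤ)]) := fun i ↦ by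
          haveI : ∀ n : Fin (N i.1), Finite ((↥(Yv i n))[(p : ℤ)]) := hYfin i
          exact finite_torsionBy_pi
        exact zpCorank_pi fun i ↦ primary_pi (hYprim i)
    _ ≤ ∑ i : ι, N i.1 * c i.1 := Finset.sum_le_sum fun i _ ↦ hinner i
    _ = ∑ v ∈ S₀, N v * c v := Finset.sum_coe_sort S₀ (fun v ↦ N v * c v)

end Summit.BirchSwinnertonDyer.BirchSwinnertonDyer.Theorems.SignedTransportAtTwo

end
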